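import Summits.ResolutionOfSingularities.ResolutionOfSingularities.Theorems.HomologicalConductorNoZenoFirstKindGerm
import Literature.AlgebraicGeometry.Resolution.ExceptionalDivisorRegularGlobal
import Literature.AlgebraicGeometry.Resolution.RegularBlowup
import Literature.AlgebraicGeometry.Resolution.CanonicalResolutionSmoothCentre
import Literature.AlgebraicGeometry.Resolution.RegularLocalRingsJacobian
import Literature.AlgebraicGeometry.Resolution.BlowupChartMembership
import Literature.AlgebraicGeometry.Resolution.KollarMonomialLocalExponents
import Literature.AlgebraicGeometry.Resolution.GenericPointStalkData
import Literature.AlgebraicGeometry.Resolution.PermissibleCentres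
import Literature.AlgebraicGeometry.Resolution.SpreadShapeData
import HarnessLib

/-!
# Crux `NoZenoR` (stmt-ResolutionOfSingularities-19943), slot 5 `stub_L1wCoreF3`, (B1) UP-5 (n3):
# THE NODE CURVES ARE REGULAR CURVES — `𝓘_n ⊄ 𝔪_w²` AT EVERY POINT — ALSO ON THE GERM RESOLUTION

OURS (cell res-hironaka, crux chain W4.4, seat res-L0-w44-stub-1 g12; the lead's RE-CUT of seam2 to ROUTE M,
STATUS 20:38:37Z, (m2): «Case A is absurd for a REGULAR node curve `n`: `∀ w ∈ closure n, stalkIdeal 𝓘_n w ⊄ 𝔪_w²`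
— please add, it is chart algebra you own»). Nothing here is a statement of the manuscript under review (Hironaka
2017); AI-written, weaker than expert review. Def-free, fact-free, `--supports 19943 --as helper`.

No chart algebra is needed: the exceptional divisor `E = V(J·𝒪_{X'})` of a blowing up `ρ : X' → X` of a regular
`X` along a regular centre `V(J)` is a REGULAR scheme (Liu 8.1.19 (b), tree `IsBlowup.isRegular_subscheme_comap`)
and an effective Cartier divisor (`IsBlowup.isEffectiveCartier`); and a principal stalk `C_w = (t)`, `t ≠ 0`, of an
ideal sheaf with regular subscheme in a regular local ring `𝒪_{X',w}` is never inside `𝔪_w²` (`𝒪_w/(t)` is regular,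
Matsumura 14.2: tree `not_isRegularLocalRing_quotient_span_singleton_of_mem_sq`). The property is then moved to
an open `U ⊆ X'` and to the germ `U ×_N Spec N_𝔮` along the FLAT morphisms `U.ι`, `pullback.fst` (tree
`stalkIdeal_comap_le_pow_iff_of_flat`, with `fst*𝓘_z = 𝓘_ζ` from `…NoZenoFirstKindGerm.comap_fst_primeDivisorIdeal`).

* §1 `not_stalkIdeal_le_maximalIdeal_sq_of_isRegular_subscheme` (general), **`IsBlowup.not_stalkIdeal_comap_le_sq`**
  (any regular centre), **`PointBlowup.not_stalkIdeal_primeDivisorIdeal_le_sq`** (blow-up of a regular closed point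
  `x`: with the bridge `η` of `…PointBlowupRegularPoint.exists_primeDivisorIdeal_eq_comap_vanishingIdeal`,
  `∀ w, η ⤳ w → ¬ stalkIdeal 𝓘_η w ≤ 𝔪_w ^ 2`).
* §2 transport: `not_stalkIdeal_primeDivisorIdeal_le_sq_iff_of_isOpenImmersion`,
  **`not_stalkIdeal_primeDivisorIdeal_le_sq_iff_fst`** (germ), so the lead's (m2) hypothesis holds VERBATIM for the
  node curves of the germ resolution `W → Spec N_𝔮`.

References: Q. Liu, *Algebraic Geometry and Arithmetic Curves* (2002), Thm. 8.1.19 (b) [`Liu2002`];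
H. Matsumura, *Commutative Ring Theory* (1986), Thm. 14.2 [`Matsumura1987`].
-/

noncomputable section

-- single-problem summit: the doubled namespace component `ResolutionOfSingularities` is forced
set_option linter.dupNamespace false

namespace Summit.ResolutionOfSingularities.ResolutionOfSingularities.Theorems.NoZeno.ExcCount

open CategoryTheory AlgebraicGeometry Limits TopologicalSpace Topology Opposite IsLocalRing
open Literature.AlgebraicGeometry.Morphisms Literature.AlgebraicGeometry.Resolution
open Scheme.IdealSheafData

universe u

/-! ## §1 A regular effective Cartier divisor has local equations of order one -/

section Order

/-- **A principal stalk of an ideal sheaf with regular subscheme is not inside `𝔪²`.** For `X` locally Noetherian,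
`V(C)` regular, `w ∈ V(C)` with `𝒪_{X,w}` regular and `C_w = (t)` with `t ≠ 0`: `¬ C_w ≤ 𝔪_w²` — otherwise
`𝒪_w/(t)`, which is the regular local ring `𝒪_{V(C),w}` (tree `isRegularLocalRing_stalk_quotient_stalkIdeal`), would
contradict Matsumura 14.2 (`not_isRegularLocalRing_quotient_span_singleton_of_mem_sq`).
[cite: Matsumura1987, Thm. 14.2] -/
theorem not_stalkIdeal_le_maximalIdeal_sq_of_isRegular_subscheme {X : Scheme.{u}} [IsLocallyNoetherian X]
    {C : X.IdealSheafData} (hC : Scheme.IsRegular C.subscheme) {w : X} (hw : w ∈ C.support)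
    [IsRegularLocalRing (X.presheaf.stalk w)] {t : X.presheaf.stalk w} (ht : stalkIdeal C w = Ideal.span {t})
    (ht0 : t ≠ 0) : ¬ stalkIdeal C w ≤ maximalIdeal (X.presheaf.stalk w) ^ 2 := by
  intro hle
  have ht2 : t ∈ maximalIdeal (X.presheaf.stalk w) ^ 2 := hle (ht ▸ Ideal.mem_span_singleton_self t)
  have hreg : IsRegularLocalRing (X.presheaf.stalk w ⧸ Ideal.span {t}) := by
    rw [← ht]; exact isRegularLocalRing_stalk_quotient_stalkIdeal hC hw
  exact not_isRegularLocalRing_quotient_span_singleton_of_mem_sq ht0 ht2 hreg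

/-- **The exceptional divisor of the blowing up of a regular centre in a regular scheme has local equations
of order exactly one**: for `ρ : X' → X` a blowing up along `J` (`X` regular locally Noetherian, `V(J)` regular,
`X'` locally Noetherian) and every point `w` of `E = V(J·𝒪_{X'})`: `¬ (J·𝒪_{X'})_w ≤ 𝔪_w²`
(`E` is regular, Liu 8.1.19 (b) = tree `IsBlowup.isRegular_subscheme_comap`; `E` is an effective Cartier divisor;
`X'` is regular, Liu 8.1.19 (a) = tree `IsBlowup.isRegular_of_isRegular_subscheme`). [cite: Liu2002, Thm. 8.1.19] -/
theorem IsBlowup.not_stalkIdeal_comap_le_sq {X X' : Scheme.{u}} [IsLocallyNoetherian X] [IsLocallyNoetherian X']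
    {ρ : X' ⟶ X} {J : X.IdealSheafData} (hX : Scheme.IsRegular X) (hJ : Scheme.IsRegular J.subscheme)
    (hρ : IsBlowup ρ J) {w : X'} (hw : w ∈ (J.comap ρ).support) :
    ¬ stalkIdeal (J.comap ρ) w ≤ maximalIdeal (X'.presheaf.stalk w) ^ 2 := by
  haveI : IsRegularLocalRing (X'.presheaf.stalk w) := hρ.isRegular_of_isRegular_subscheme hX hJ w
  obtain ⟨t, ht, hspan⟩ := hρ.isEffectiveCartier.exists_stalkIdeal_eq_span w
  exact not_stalkIdeal_le_maximalIdeal_sq_of_isRegular_subscheme (hρ.isRegular_subscheme_comap hX hJ) hw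
    hspan (nonZeroDivisors.ne_zero ht)

/-- **The exceptional curve of the blow-up of a regular closed point is a regular curve, in the «order one» form the
closer consumes.** For `ρ : X' → X` the blowing up of a closed point `x` of a regular locally Noetherian `X` with
`dim 𝒪_{X,x} ≥ 1` (`X'` locally Noetherian) and `η` the generic point of `ρ⁻¹{x}` with `𝓘_η = 𝓘_{x}·𝒪_{X'}`
(`…PointBlowupRegularPoint.exists_primeDivisorIdeal_eq_comap_vanishingIdeal`): at every point `w` of the curve
`cl{η}`, `¬ (𝓘_η)_w ≤ 𝔪_w ^ 2`. [this work] -/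
theorem PointBlowup.not_stalkIdeal_primeDivisorIdeal_le_sq {X X' : Scheme.{u}} [IsLocallyNoetherian X]
    [IsLocallyNoetherian X'] (hX : Scheme.IsRegular X) {ρ : X' ⟶ X} (x : X) (hx : IsClosed ({x} : Set X))
    (hρ : IsBlowup ρ (vanishingIdeal ⟨{x}, hx⟩)) {η : X'}
    (hη : primeDivisorIdeal η = (vanishingIdeal ⟨{x}, hx⟩).comap ρ) {w : X'} (hw : η ⤳ w) :
    ¬ stalkIdeal (primeDivisorIdeal η) w ≤ maximalIdeal (X'.presheaf.stalk w) ^ 2 := by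
  rw [hη]
  refine IsBlowup.not_stalkIdeal_comap_le_sq hX (isRegular_subscheme_vanishingIdeal_singleton hx) hρ ?_
  rw [← hη]
  exact (mem_support_primeDivisorIdeal_iff η w).mpr hw

end Order

/-! ## §2 Transport along flat morphisms: open subschemes and the germ -/

section Transport

/-- `𝓘_w` has stalk `𝔪_w` at `w` (the reduced closure of a point, tree `stalkIdeal_vanishingIdeal_closure_self`).
[folklore] -/
theorem stalkIdeal_primeDivisorIdeal_self {X : Scheme.{u}} (w : X) :
    stalkIdeal (primeDivisorIdeal w) w = maximalIdeal (X.presheaf.stalk w) :=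
  stalkIdeal_vanishingIdeal_closure_self w

/-- **Order one is local along flat morphisms compatible with prime divisor ideals.** For `f : Y → X` flat,
`y ∈ Y`, and points `η' ⤳ y` upstairs, `η ⤳ f y` downstairs with `f*𝓘_η = 𝓘_{η'}` and `f*𝓘_{f y} = 𝓘_y`
(e.g. `f` an open immersion, or the first projection of the germ base change):
`¬ (𝓘_{η'})_y ≤ 𝔪_y² ↔ ¬ (𝓘_η)_{f y} ≤ 𝔪_{f y}²` (tree `stalkIdeal_comap_le_pow_iff_of_flat`: extension along the
faithfully flat `𝒪_{X,f y} → 𝒪_{Y,y}` reflects inclusions). [folklore] -/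
theorem not_stalkIdeal_primeDivisorIdeal_le_sq_iff_of_flat {X Y : Scheme.{u}} (f : Y ⟶ X) [Flat f]
    {η' y : Y} {η : X} (hη : (primeDivisorIdeal η).comap f = primeDivisorIdeal η')
    (hy : (primeDivisorIdeal (f.base y)).comap f = primeDivisorIdeal y) :
    (¬ stalkIdeal (primeDivisorIdeal η') y ≤ maximalIdeal (Y.presheaf.stalk y) ^ 2) ↔
      ¬ stalkIdeal (primeDivisorIdeal η) (f.base y) ≤ maximalIdeal (X.presheaf.stalk (f.base y)) ^ 2 := by
  rw [not_iff_not, ← stalkIdeal_primeDivisorIdeal_self y, ← stalkIdeal_primeDivisorIdeal_self (f.base y),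
    ← hη, ← hy]
  exact stalkIdeal_comap_le_pow_iff_of_flat f (primeDivisorIdeal η) (primeDivisorIdeal (f.base y)) y 2

/-- Open-immersion instance: for `U ⊆ X` open and `z ⤳ y` in `U`,
`¬ (𝓘_z)_y ≤ 𝔪_y² ↔ ¬ (𝓘_{ι z})_{ι y} ≤ 𝔪_{ι y}²` (`ι*𝓘_{ι z} = 𝓘_z`, `…FirstKindGerm.comap_primeDivisorIdeal_of_isOpenImmersion`).
[folklore] -/
theorem not_stalkIdeal_primeDivisorIdeal_le_sq_iff_of_isOpenImmersion {X Y : Scheme.{u}} (f : Y ⟶ X)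
    [IsOpenImmersion f] (z y : Y) :
    (¬ stalkIdeal (primeDivisorIdeal z) y ≤ maximalIdeal (Y.presheaf.stalk y) ^ 2) ↔
      ¬ stalkIdeal (primeDivisorIdeal (f.base z)) (f.base y) ≤ maximalIdeal (X.presheaf.stalk (f.base y)) ^ 2 :=
  not_stalkIdeal_primeDivisorIdeal_le_sq_iff_of_flat f (comap_primeDivisorIdeal_of_isOpenImmersion f z)
    (comap_primeDivisorIdeal_of_isOpenImmersion f y)

variable {N N' : Type u} [CommRing N] [CommRing N'] [Algebra N N'] (𝔮 : Ideal N) [𝔮.IsMaximal]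
  [IsLocalization.AtPrime N' 𝔮] {V : Scheme.{u}} (σ : V ⟶ Spec (.of N))

/-- **GERM instance: the node curves of the germ resolution are regular curves.** For `σ : V → Spec N`, `𝔮` maximal,
`N' = N_𝔮`, `g = Spec(N → N')`, `fst = pullback.fst σ g` and points `ζ ⤳ w` of `V ×_N Spec N'` with `fst ζ` over `𝔮`:
`¬ (𝓘_ζ)_w ≤ 𝔪_w² ↔ ¬ (𝓘_{fst ζ})_{fst w} ≤ 𝔪_{fst w}²` (`fst` is flat — a base change of the flat `g` — and
`fst*𝓘_{fst ζ} = 𝓘_ζ`, `fst*𝓘_{fst w} = 𝓘_w` by `…FirstKindGerm.comap_fst_primeDivisorIdeal`, `w` lying over `𝔮` too).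
So the ROUTE-M (m2) hypothesis «`∀ w ∈ closure n, stalkIdeal 𝓘_n w ⊄ 𝔪_w²`» for a node curve `n` of the germ
resolution follows from `PointBlowup.not_stalkIdeal_primeDivisorIdeal_le_sq` on `X¹` through
`…_iff_of_isOpenImmersion` (chart open `U ⊆ X¹`) and this lemma. [this work] -/
theorem not_stalkIdeal_primeDivisorIdeal_le_sq_iff_fst
    {ζ w : ↑(pullback σ (Spec.map (CommRingCat.ofHom (algebraMap N N'))))}
    (hζ : σ.base ((pullback.fst σ (Spec.map (CommRingCat.ofHom (algebraMap N N')))).base ζ) =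
      ⟨𝔮, inferInstance⟩) (hw : ζ ⤳ w) :
    (¬ stalkIdeal (primeDivisorIdeal ζ) w ≤
        maximalIdeal ((pullback σ (Spec.map (CommRingCat.ofHom (algebraMap N N')))).presheaf.stalk w) ^ 2) ↔
      ¬ stalkIdeal (primeDivisorIdeal ((pullback.fst σ (Spec.map (CommRingCat.ofHom (algebraMap N N')))).base ζ))
          ((pullback.fst σ (Spec.map (CommRingCat.ofHom (algebraMap N N')))).base w) ≤
        maximalIdeal (V.presheaf.stalk
          ((pullback.fst σ (Spec.map (CommRingCat.ofHom (algebraMap N N')))).base w)) ^ 2 := by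
  haveI : Flat (Spec.map (CommRingCat.ofHom (algebraMap N N'))) := by
    haveI : Module.Flat N N' := IsLocalization.flat N' 𝔮.primeCompl
    rw [HasRingHomProperty.Spec_iff (P := @Flat)]
    exact RingHom.flat_algebraMap_iff.mpr inferInstance
  have hwq : σ.base ((pullback.fst σ (Spec.map (CommRingCat.ofHom (algebraMap N N')))).base w) =
      ⟨𝔮, inferInstance⟩ :=
    base_eq_of_specializes 𝔮 σ hζ
      (hw.map (pullback.fst σ (Spec.map (CommRingCat.ofHom (algebraMap N N')))).base.hom.continuous)
  exact not_stalkIdeal_primeDivisorIdeal_le_sq_iff_of_flat _ (comap_fst_primeDivisorIdeal 𝔮 σ ζ hζ)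
    (comap_fst_primeDivisorIdeal 𝔮 σ w hwq)

end Transport

/-! ### At a node of a finite centre: the blow-up of `Z ∋ x` with `x` isolated in `Z` -/

section Node

variable {X X' : Scheme.{u}} [IsLocallyNoetherian X] [IsLocallyNoetherian X'] (hX : Scheme.IsRegular X)
  {ρ : X' ⟶ X} (Z : Closeds X) (hρ : IsBlowup ρ (vanishingIdeal Z))
  (x : X) (hx : IsClosed ({x} : Set X)) (U : X.Opens) (hxU : x ∈ U) (hZU : (Z : Set X) ∩ U = {x})
  (hne : maximalIdeal (X.presheaf.stalk x) ≠ ⊥)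

include hX hρ hxU hZU hne in
omit [IsLocallyNoetherian X'] in
/-- **The node curve of a finite centre, as a prime divisor ideal.** Let `ρ : X' → X` be a blowing up of the reduced
ideal of a closed `Z ⊆ X` (`X` regular, locally Noetherian; `X'` locally Noetherian), `x ∈ Z` a closed point ISOLATED in
`Z` (`Z ∩ U = {x}` for an open `U`) with `dim 𝒪_{X,x} ≥ 1`. Then the fibre `ρ⁻¹{x}` is the closure of a point `η` and
`𝓘_η = 𝓘_{x}·𝒪_{X'}` — the one-point statement `…PointBlowupRegularPoint.exists_primeDivisorIdeal_eq_comap_vanishingIdeal`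
for the restricted blow-up `ρ⁻¹U → U` (which blows up `𝓘_{x}`, `PointBlowup.comap_ι_vanishingIdeal_eq_singleton`), glued
along the open immersion `ρ⁻¹U ↪ X'` stalkwise (both ideals are trivial off `ρ⁻¹{x} ⊆ ρ⁻¹U`). The ideal form of
res-L1-type-o5's `hnode`; the currency bridge between `…PointBlowupNode.h0_comap_vanishingIdeal_node` (UP-5 at a node)
and `…FirstKindGerm` / `Lipman1969_27_1_reg_rat`. [this work] -/
theorem PointBlowup.exists_primeDivisorIdeal_eq_comap_vanishingIdeal_node :
    ∃ η : X', closure {η} = ρ.base ⁻¹' {x} ∧ primeDivisorIdeal η = (vanishingIdeal ⟨{x}, hx⟩).comap ρ := by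
  -- the point `x' = x` of the open subscheme `U`; the restricted blow-up blows up `𝓘_{x'}`
  set x' : ↥(U : Scheme.{u}) := ⟨x, hxU⟩ with hx'
  have hx'c : IsClosed ({x'} : Set ↥(U : Scheme.{u})) := PointBlowup.isClosed_singleton_opens U x hxU hx
  have hne' : maximalIdeal ((U : Scheme.{u}).presheaf.stalk x') ≠ ⊥ := by
    intro hbot
    apply hne
    have hf : IsField ((U : Scheme.{u}).presheaf.stalk x') := (isField_iff_maximalIdeal_eq).mpr hbot
    exact (isField_iff_maximalIdeal_eq).mp
      (MulEquiv.isField hf (asIso (U.ι.stalkMap x')).commRingCatIsoToRingEquiv.toMulEquiv)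
  have hJU : (vanishingIdeal Z).comap U.ι = vanishingIdeal ⟨{x'}, hx'c⟩ :=
    PointBlowup.comap_ι_vanishingIdeal_eq_singleton Z U x hxU hx hZU
  have hJU' : (vanishingIdeal ⟨{x}, hx⟩).comap U.ι = vanishingIdeal ⟨{x'}, hx'c⟩ :=
    PointBlowup.comap_ι_vanishingIdeal_eq_singleton ⟨{x}, hx⟩ U x hxU hx
      (by ext y; simp only [Set.mem_inter_iff, Set.mem_singleton_iff, Closeds.coe_mk]
          exact ⟨fun h => h.1, fun h => ⟨h, h ▸ hxU⟩⟩)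
  have hρ' : IsBlowup (ρ ∣_ U) (vanishingIdeal ⟨{x'}, hx'c⟩) := by
    rw [← hJU]; exact hρ.restrict U
  have hU : Scheme.IsRegular (U : Scheme.{u}) := Scheme.IsRegular.of_isOpenImmersion U.ι hX
  -- the one-point bridge on `ρ⁻¹U → U`
  obtain ⟨η', hcl', hη'⟩ := PointBlowup.exists_primeDivisorIdeal_eq_comap_vanishingIdeal hU x' hx'c hρ' hne'
  have hideal : ((vanishingIdeal ⟨{x}, hx⟩).comap ρ).comap (ρ ⁻¹ᵁ U).ι =
      (vanishingIdeal ⟨{x'}, hx'c⟩).comap (ρ ∣_ U) := by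
    rw [← comap_comp, ← morphismRestrict_ι, comap_comp, hJU']
  refine ⟨(ρ ⁻¹ᵁ U).ι.base η', ?_, ?_⟩
  · -- `closure {η} = ρ⁻¹{x}`: `⊆` as `ρ⁻¹{x}` is closed and contains `η`; `⊇` through `ρ⁻¹U`
    apply Set.Subset.antisymm
    · refine (hx.preimage ρ.base.hom.continuous).closure_subset_iff.mpr ?_
      rw [Set.singleton_subset_iff, Set.mem_preimage, Set.mem_singleton_iff]
      have h1 : η' ∈ (ρ ∣_ U).base ⁻¹' {x'} := by rw [← hcl']; exact subset_closure rfl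
      have h2 : (ρ ∣_ U).base η' = x' := h1
      have h3 := congrArg (fun p : ↥(U : Scheme.{u}) => U.ι.base p) h2
      simp only at h3
      rw [← Scheme.Hom.comp_apply, morphismRestrict_ι, Scheme.Hom.comp_apply] at h3
      exact h3
    · intro w hw
      have hwU : w ∈ (ρ ⁻¹ᵁ U : X'.Opens) := by
        change ρ.base w ∈ U
        rw [Set.mem_preimage, Set.mem_singleton_iff] at hw
        rw [hw]; exact hxU
      have hw' : (⟨w, hwU⟩ : ↥(ρ ⁻¹ᵁ U : Scheme.{u})) ∈ (ρ ∣_ U).base ⁻¹' {x'} := by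
        change (ρ ∣_ U).base ⟨w, hwU⟩ = x'
        apply Subtype.ext
        change U.ι.base ((ρ ∣_ U).base ⟨w, hwU⟩) = x
        rw [← Scheme.Hom.comp_apply, morphismRestrict_ι, Scheme.Hom.comp_apply]
        exact hw
      rw [← hcl'] at hw'
      -- `closure {η'} ⊆ ι⁻¹ closure {ι η'}`
      have hsub : closure ({η'} : Set ↥(ρ ⁻¹ᵁ U : Scheme.{u})) ⊆
          (ρ ⁻¹ᵁ U).ι.base ⁻¹' closure {(ρ ⁻¹ᵁ U).ι.base η'} := by
        refine closure_minimal ?_ (isClosed_closure.preimage (ρ ⁻¹ᵁ U).ι.base.hom.continuous)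
        rw [Set.singleton_subset_iff]; exact subset_closure rfl
      exact hsub hw'
  · -- the two ideal sheaves agree stalkwise
    apply ext_of_forall_stalkIdeal_eq
    intro w
    by_cases hwU : w ∈ (ρ ⁻¹ᵁ U : X'.Opens)
    · have key := stalkIdeal_eq_of_comap_eq_of_isOpenImmersion (ρ ⁻¹ᵁ U).ι
        (I := primeDivisorIdeal ((ρ ⁻¹ᵁ U).ι.base η')) (J := (vanishingIdeal ⟨{x}, hx⟩).comap ρ)
        (by rw [comap_primeDivisorIdeal_of_isOpenImmersion, hideal, hη']) ⟨w, hwU⟩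
      exact key
    · -- off `ρ⁻¹U` both stalks are the unit ideal
      have hwx : ρ.base w ≠ x := fun h => hwU (by change ρ.base w ∈ U; rw [h]; exact hxU)
      have h1 : w ∉ ((vanishingIdeal ⟨{x}, hx⟩).comap ρ).support := by
        rw [support_comap]
        intro h
        have h' : ρ.base w ∈ ((vanishingIdeal (⟨{x}, hx⟩ : Closeds X)).support : Set X) := h
        rw [coe_support_vanishingIdeal] at h'
        exact hwx h'
      have h2 : w ∉ (primeDivisorIdeal ((ρ ⁻¹ᵁ U).ι.base η')).support := by
        intro h
        rw [mem_support_primeDivisorIdeal_iff] at h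
        -- `η ⤳ w` forces `ρ w = x`
        have : ρ.base ((ρ ⁻¹ᵁ U).ι.base η') ⤳ ρ.base w := h.map ρ.base.hom.continuous
        have hρη : ρ.base ((ρ ⁻¹ᵁ U).ι.base η') = x := by
          have h1 : η' ∈ (ρ ∣_ U).base ⁻¹' {x'} := by rw [← hcl']; exact subset_closure rfl
          have h2 : (ρ ∣_ U).base η' = x' := h1
          have h3 := congrArg (fun p : ↥(U : Scheme.{u}) => U.ι.base p) h2
          simp only at h3
          rw [← Scheme.Hom.comp_apply, morphismRestrict_ι, Scheme.Hom.comp_apply] at h3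
          exact h3
        rw [hρη] at this
        exact hwx ((this.mem_closed hx rfl).symm ▸ rfl)
      rw [stalkIdeal_eq_top_of_not_mem_support h2, stalkIdeal_eq_top_of_not_mem_support h1]

include hX hρ hxU hZU in
/-- **The node curve over an isolated point of a finite regular-point centre is a regular curve** (order-one form):
with `η` as in `PointBlowup.exists_primeDivisorIdeal_eq_comap_vanishingIdeal_node` (`𝓘_η = 𝓘_{x}·𝒪_{X'}`), at every
`w` with `η ⤳ w`: `¬ (𝓘_η)_w ≤ 𝔪_w ^ 2` — the one-point statement on `ρ⁻¹U → U`, moved along the open immersion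
`ρ⁻¹U ↪ X'`. [this work] -/
theorem PointBlowup.not_stalkIdeal_primeDivisorIdeal_le_sq_node {η : X'}
    (hη : primeDivisorIdeal η = (vanishingIdeal ⟨{x}, hx⟩).comap ρ) {w : X'} (hw : η ⤳ w) :
    ¬ stalkIdeal (primeDivisorIdeal η) w ≤ maximalIdeal (X'.presheaf.stalk w) ^ 2 := by
  set x' : ↥(U : Scheme.{u}) := ⟨x, hxU⟩ with hx'
  have hx'c : IsClosed ({x'} : Set ↥(U : Scheme.{u})) := PointBlowup.isClosed_singleton_opens U x hxU hx
  have hJU : (vanishingIdeal Z).comap U.ι = vanishingIdeal ⟨{x'}, hx'c⟩ :=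
    PointBlowup.comap_ι_vanishingIdeal_eq_singleton Z U x hxU hx hZU
  have hJU' : (vanishingIdeal ⟨{x}, hx⟩).comap U.ι = vanishingIdeal ⟨{x'}, hx'c⟩ :=
    PointBlowup.comap_ι_vanishingIdeal_eq_singleton ⟨{x}, hx⟩ U x hxU hx
      (by ext y; simp only [Set.mem_inter_iff, Set.mem_singleton_iff, Closeds.coe_mk]
          exact ⟨fun h => h.1, fun h => ⟨h, h ▸ hxU⟩⟩)
  have hρ' : IsBlowup (ρ ∣_ U) (vanishingIdeal ⟨{x'}, hx'c⟩) := by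
    rw [← hJU]; exact hρ.restrict U
  have hU : Scheme.IsRegular (U : Scheme.{u}) := Scheme.IsRegular.of_isOpenImmersion U.ι hX
  have hideal : ((vanishingIdeal ⟨{x}, hx⟩).comap ρ).comap (ρ ⁻¹ᵁ U).ι =
      (vanishingIdeal ⟨{x'}, hx'c⟩).comap (ρ ∣_ U) := by
    rw [← comap_comp, ← morphismRestrict_ι, comap_comp, hJU']
  -- `η` and `w` lie in `ρ⁻¹U` (they are over `x`)
  have hηx : ρ.base η = x := by
    have : η ∈ (primeDivisorIdeal η).support := (mem_support_primeDivisorIdeal_iff η η).mpr le_rfl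
    rw [hη, support_comap] at this
    have h' : ρ.base η ∈ ((vanishingIdeal (⟨{x}, hx⟩ : Closeds X)).support : Set X) := this
    rwa [coe_support_vanishingIdeal] at h'
  have hwx : ρ.base w = x := by
    have := hw.map ρ.base.hom.continuous
    rw [hηx] at this
    exact ((this.mem_closed hx rfl)).symm ▸ rfl
  have hηU : η ∈ (ρ ⁻¹ᵁ U : X'.Opens) := by change ρ.base η ∈ U; rw [hηx]; exact hxU
  have hwU : w ∈ (ρ ⁻¹ᵁ U : X'.Opens) := by change ρ.base w ∈ U; rw [hwx]; exact hxU
  -- the bridge for `η` seen in `ρ⁻¹U`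
  have hη' : primeDivisorIdeal (⟨η, hηU⟩ : ↥(ρ ⁻¹ᵁ U : Scheme.{u})) =
      (vanishingIdeal ⟨{x'}, hx'c⟩).comap (ρ ∣_ U) := by
    rw [← hideal, ← hη]
    exact (comap_primeDivisorIdeal_of_isOpenImmersion (ρ ⁻¹ᵁ U).ι ⟨η, hηU⟩).symm
  have hw' : (⟨η, hηU⟩ : ↥(ρ ⁻¹ᵁ U : Scheme.{u})) ⤳ ⟨w, hwU⟩ :=
    ((ρ ⁻¹ᵁ U).ι.isEmbedding.specializes_iff).mp hw
  have key := PointBlowup.not_stalkIdeal_primeDivisorIdeal_le_sq hU x' hx'c hρ' hη' hw'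
  exact (not_stalkIdeal_primeDivisorIdeal_le_sq_iff_of_isOpenImmersion (ρ ⁻¹ᵁ U).ι ⟨η, hηU⟩ ⟨w, hwU⟩).mp key

end Node

end Summit.ResolutionOfSingularities.ResolutionOfSingularities.Theorems.NoZeno.ExcCount

end
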